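import Summits.QuantumFields.YangMills.Theorems.UnitScaleTiltProp7LapCombLocal
import Summits.QuantumFields.YangMills.Theorems.UnitScaleTiltProp7LapCombRegroup
import HarnessLib

/-!
# Route `UnitScaleTilt`, crux K1 «MinimiserStabilityRegPr» (stmt-QuantumFields-19200), route-R E′, S3 K-form engine, ROW (H) — hLap INHABITANT, FILE F (ℤ^d comb letters):
# THE COVARIANT LAPLACIAN OF A COMB LOCAL MODEL AT ONE SITE, SITE-CURRENT FORM — summing ✓ `Prop7LapCombLocal` over the directions `μ` and regrouping the localised rung
# differences by comb site with ✓ `Prop7LapCombRegroup`: `‖Σ_μ (2m − R(h(v−e_μ,μ))⁻¹m − R(h(v,μ))m)‖ ≤ Σ_(sites p of Γ(0,v)) N_m(Σ_(μ before p's run) Loc(μ,p)) + 15a·Σ_μ|B_μ|·(FAM families)`,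
# where `Loc(μ,p) = 𝒯(p)·(P(p,μ) − V(p−e_μ,μ)⁻¹P(p−e_μ,μ)V(p−e_μ,μ))·𝒯(p)⁻¹` is the comb-transported LOCAL covariant curvature difference — at the sites of the LAST run the inner
# sum runs over ALL other directions (the current letter of ✓ `Prop7CurrentConjugationDefect`, bookable by J-ROW★), the norm being taken AFTER it

Cell `ym3-torus`, width seat `ym3-torus-px4` (gen 4); ★ym-ust-19200-p1 g16 NAMER WORD 14 «px4 g4: hLap INHABITANT GO» (2026-08-29 00:17Z), road (iii) (★w4 g7; (N3) TABLE 2).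
THEOREMS ONLY (0 `def`, 0 `sorry`); `--supports stmt-QuantumFields-19200`, count-neutral.  YM₃ on T³ is a ladder rung (R3), not the Clay problem; nothing here claims hLap, hRes, (H),
S3, E′, a stub, the crux, d = 4 or the mass gap.

WHAT IS PROVED (ns `…Theorems.Prop7LapCombSites`; `V : Site d → Fin d → 𝔸ˣ` bi-contractive, splits `hsplit : ∀ μ, (finRange d).reverse = s μ ++ μ :: t μ`, site `v`).
* §1 `flatMap_seg_sub_e`, `sub_e_apply_self`, `disp_prefix_pred` (letters of the shifted site `v − e_μ`).
* §2 ★★ `norm_lapDefect_comb_add_comm_local_le'` — ✓ `Prop7LapCombLocal.norm_lapDefect_comb_add_comm_local_le` at `w := v − e_μ`, every rung term written as a function of the rung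
  POINT `p = q_μ + disp(B_μ↾k)` alone (the neighbour as `p − e_μ`): the shape ✓ `Prop7LapCombRegroup` consumes.
* §3 ★★★ `norm_lapSum_comb_le_sites` — the title bound (one decl-local `maxHeartbeats 400000`, README budget rule).
* §4 ★★★ `norm_lapSum_comb_add_comm_sites_le` (v1.1) — the same with the site-regrouped first-order term kept EXACT inside the norm (for the offset-family telescoping).
HONEST SCOPE.  Assembly of landed files; no count over `v`, no T³, no booking of the site-current family (that is the displayed J-ROW★-type row of the LOCATE, evidence #46).

References: T. Bałaban, CMP 99 (1985) 75–102 [Balaban1985RegularSpaces] ((1.1)–(1.2) p.76, (1.9) p.77); CMP 99 (1985) 389–434 [Balaban1985BackgroundPropagators] ((3.3)–(3.4)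
pp.390–391, (3.8)–(3.9) p.392); CMP 98 (1985) 17–51 [Balaban1985Averaging] ((9) pp.18–19, (19)–(20) p.21, p.24); CMP 102 (1985) 255–275 [Balaban1985UV3] ((27) p.263).
-/

set_option autoImplicit false

noncomputable section

open scoped BigOperators

namespace Summit.QuantumFields.YangMills.Theorems.Prop7LapCombSites

open Literature.MathematicalPhysics.QuantumFieldTheory.Balaban1983to89
open B7Prop1Explicit (Site Letter e disp revWord seg treeWord hol disp_append)
open B10Eq27AxialLog (contour27)
open B9Eq39Adjoint (R R_def)
open Summit.QuantumFields.YangMills.Theorems.Prop7LapCombLocal (norm_lapDefect_comb_add_comm_local_le)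
open Summit.QuantumFields.YangMills.Theorems.Prop7LapCombRegroup (norm_comm_sum_dirs_tailRungs_le)

/-! ## §1 Letters of the shifted site -/

section Letters

variable {d : ℕ}

/-- the runs of the other directions do not see `v ↦ v − e_μ`. [folklore] -/
theorem flatMap_seg_sub_e (v : Site d) (μ : Fin d) {l : List (Fin d)} (hl : μ ∉ l) :
    l.flatMap (fun κ => seg κ ((v - e μ) κ)) = l.flatMap (fun κ => seg κ (v κ)) := by
  refine List.flatMap_congr fun κ hκ => ?_
  have hne : κ ≠ μ := fun hh => hl (hh ▸ hκ)
  rw [Pi.sub_apply, B7Prop1Explicit.e_apply, if_neg hne, sub_zero]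

/-- `(v − e_μ) μ = v μ − 1`. [folklore] -/
theorem sub_e_apply_self (v : Site d) (μ : Fin d) : (v - e μ) μ = v μ - 1 := by
  rw [Pi.sub_apply, B7Prop1Explicit.e_apply, if_pos rfl]

/-- the base one unit back: `disp(A ++ seg μ (n − 1)) = disp(A ++ seg μ n) − e_μ`. [folklore] -/
theorem disp_prefix_pred (A : List (Letter d)) (μ : Fin d) (n : ℤ) : disp (A ++ seg μ (n - 1)) = disp (A ++ seg μ n) - e μ := by
  rw [disp_append, disp_append, B7Prop1Explicit.disp_seg, B7Prop1Explicit.disp_seg, sub_smul, one_smul, add_sub_assoc]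

end Letters

/-! ## §2 One direction, rung-point form -/

section PerDirection

variable {d : ℕ} {𝔸 : Type*} [NormedRing 𝔸] [NormOneClass 𝔸] (V : Site d → Fin d → 𝔸ˣ)
  (hV : ∀ (x : Site d) (κ : Fin d), ‖(V x κ : 𝔸)‖ ≤ 1 ∧ ‖(((V x κ)⁻¹ : 𝔸ˣ) : 𝔸)‖ ≤ 1)

include hV in
set_option maxHeartbeats 400000 in
/-- ★★ **ONE DIRECTION, RUNG-POINT FORM**: ✓ `norm_lapDefect_comb_add_comm_local_le` at `w := v − e_μ` (so the pair is `h(v−e_μ,μ), h(v,μ)` of ✓ `lap_axialModel`), every rung term a function of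
the rung point `p = q_μ + disp(B_μ↾k)` and the neighbour `p − e_μ`. [cite: Balaban1985RegularSpaces, (1.1)-(1.2) p.76; Balaban1985BackgroundPropagators, (3.3)-(3.4) pp.390-391; Balaban1985Averaging, (9) pp.18-19, p.24] -/
theorem norm_lapDefect_comb_add_comm_local_le' (μ : Fin d) {s t : List (Fin d)} (h : (List.finRange d).reverse = s ++ μ :: t) (hs : μ ∉ s) (ht : μ ∉ t)
    (v : Site d) (m : 𝔸) {a : ℝ} (ha : 0 ≤ a) (hplaq : ∀ (x : Site d) (l : Letter d), ‖((hol V x [l, (μ, true), l.rev, (μ, false)] : 𝔸ˣ) : 𝔸) - 1‖ ≤ a)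
    (han : a * (t.flatMap (fun κ => seg κ (v κ))).length ≤ 1) :
    ‖((2 : ℕ) • m - R (hol V 0 (contour27 0 (v - e μ) μ))⁻¹ m - R (hol V 0 (contour27 0 v μ)) m)
        + ((∑ k ∈ Finset.range (t.flatMap (fun κ => seg κ (v κ))).length, ((hol V 0 (treeWord (disp (s.flatMap (fun κ => seg κ (v κ)) ++ seg μ (v μ)) + disp ((t.flatMap (fun κ => seg κ (v κ))).take k))) : 𝔸ˣ) : 𝔸) * (((hol V (disp (s.flatMap (fun κ => seg κ (v κ)) ++ seg μ (v μ)) + disp ((t.flatMap (fun κ => seg κ (v κ))).take k)) [(t.flatMap (fun κ => seg κ (v κ))).getD k (μ, true), (μ, true), ((t.flatMap (fun κ => seg κ (v κ))).getD k (μ, true)).rev, (μ, false)] : 𝔸ˣ) : 𝔸) - ((((V ((disp (s.flatMap (fun κ => seg κ (v κ)) ++ seg μ (v μ)) + disp ((t.flatMap (fun κ => seg κ (v κ))).take k)) - e μ) μ)⁻¹ * hol V ((disp (s.flatMap (fun κ => seg κ (v κ)) ++ seg μ (v μ)) + disp ((t.flatMap (fun κ => seg κ (v κ))).take k)) - e μ)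 [(t.flatMap (fun κ => seg κ (v κ))).getD k (μ, true), (μ, true), ((t.flatMap (fun κ => seg κ (v κ))).getD k (μ, true)).rev, (μ, false)] * ((V ((disp (s.flatMap (fun κ => seg κ (v κ)) ++ seg μ (v μ)) + disp ((t.flatMap (fun κ => seg κ (v κ))).take k)) - e μ) μ)⁻¹)⁻¹ : 𝔸ˣ) : 𝔸))) * (((hol V 0 (treeWord (disp (s.flatMap (fun κ => seg κ (v κ)) ++ seg μ (v μ)) + disp ((t.flatMap (fun κ => seg κ (v κ))).take k))))⁻¹ : 𝔸ˣ) : 𝔸)) * m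
          - m * ∑ k ∈ Finset.range (t.flatMap (fun κ => seg κ (v κ))).length, ((hol V 0 (treeWord (disp (s.flatMap (fun κ => seg κ (v κ)) ++ seg μ (v μ)) + disp ((t.flatMap (fun κ => seg κ (v κ))).take k))) : 𝔸ˣ) : 𝔸) * (((hol V (disp (s.flatMap (fun κ => seg κ (v κ)) ++ seg μ (v μ)) + disp ((t.flatMap (fun κ => seg κ (v κ))).take k)) [(t.flatMap (fun κ => seg κ (v κ))).getD k (μ, true), (μ, true), ((t.flatMap (fun κ => seg κ (v κ))).getD k (μ, true)).rev, (μ, false)] : 𝔸ˣ) : 𝔸) - ((((V ((disp (s.flatMap (fun κ => seg κ (v κ)) ++ seg μ (v μ)) + disp ((t.flatMap (fun κ => seg κ (v κ))).take k)) - e μ) μ)⁻¹ * hol V ((disp (s.flatMap (fun κ => seg κ (v κ)) ++ seg μ (v μ)) + disp ((t.flatMap (fun κ => seg κ (v κ))).take k)) - e μ) [(t.flatMap (fun κ => seg κ (v κ))).getD k (μ, true), (μ, true), ((t.flatMap (fun κ => seg κ (v κ))).getD k (μ, true)).rev, (μ, false)] * ((V ((disp (s.flatMap (fun κ => seg κ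 (v κ)) ++ seg μ (v μ)) + disp ((t.flatMap (fun κ => seg κ (v κ))).take k)) - e μ) μ)⁻¹)⁻¹ : 𝔸ˣ) : 𝔸))) * (((hol V 0 (treeWord (disp (s.flatMap (fun κ => seg κ (v κ)) ++ seg μ (v μ)) + disp ((t.flatMap (fun κ => seg κ (v κ))).take k))))⁻¹ : 𝔸ˣ) : 𝔸))‖
      ≤ 15 * a * (t.flatMap (fun κ => seg κ (v κ))).length
          * (∑ k ∈ Finset.range (t.flatMap (fun κ => seg κ (v κ))).length, ‖((hol V (disp (s.flatMap (fun κ => seg κ (v κ)) ++ seg μ (v μ)) + disp ((t.flatMap (fun κ => seg κ (v κ))).take k)) [(t.flatMap (fun κ => seg κ (v κ))).getD k (μ, true), (μ, true), ((t.flatMap (fun κ => seg κ (v κ))).getD k (μ, true)).rev, (μ, false)] : 𝔸ˣ) : 𝔸) * R (hol V 0 (treeWord (disp (s.flatMap (fun κ => seg κ (v κ)) ++ seg μ (v μ)) + disp ((t.flatMap (fun κ => seg κ (v κ))).take k))))⁻¹ m - R (hol V 0 (treeWord (disp (s.flatMap (fun κ => seg κ (v κ)) ++ seg μ (v μ)) +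 disp ((t.flatMap (fun κ => seg κ (v κ))).take k))))⁻¹ m * ((hol V (disp (s.flatMap (fun κ => seg κ (v κ)) ++ seg μ (v μ)) + disp ((t.flatMap (fun κ => seg κ (v κ))).take k)) [(t.flatMap (fun κ => seg κ (v κ))).getD k (μ, true), (μ, true), ((t.flatMap (fun κ => seg κ (v κ))).getD k (μ, true)).rev, (μ, false)] : 𝔸ˣ) : 𝔸)‖
            + ∑ k ∈ Finset.range (t.flatMap (fun κ => seg κ (v κ))).length, ‖((hol V ((disp (s.flatMap (fun κ => seg κ (v κ)) ++ seg μ (v μ)) + disp ((t.flatMap (fun κ => seg κ (v κ))).take k)) - e μ) [(t.flatMap (fun κ => seg κ (v κ))).getD k (μ, true), (μ, true), ((t.flatMap (fun κ => seg κ (v κ))).getD k (μ, true)).rev, (μ, false)] : 𝔸ˣ) : 𝔸) * R (hol V 0 (treeWord ((disp (s.flatMap (fun κ => seg κ (v κ)) ++ seg μ (v μ)) + disp ((t.flatMap (fun κ => seg κ (v κ))).take k)) - e μ)))⁻¹ m - R (hol V 0 (treeWord ((disp (s.flatMap (fun κ => seg κ (v κ)) ++ seg μ (v μ)) + disp ((t.flatMap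 (fun κ => seg κ (v κ))).take k)) - e μ)))⁻¹ m * ((hol V ((disp (s.flatMap (fun κ => seg κ (v κ)) ++ seg μ (v μ)) + disp ((t.flatMap (fun κ => seg κ (v κ))).take k)) - e μ) [(t.flatMap (fun κ => seg κ (v κ))).getD k (μ, true), (μ, true), ((t.flatMap (fun κ => seg κ (v κ))).getD k (μ, true)).rev, (μ, false)] : 𝔸ˣ) : 𝔸)‖) := by
  have hE := norm_lapDefect_comb_add_comm_local_le V hV μ h hs ht (v - e μ) m ha hplaq (by rwa [flatMap_seg_sub_e v μ ht])
  have hq : disp (s.flatMap (fun κ => seg κ (v κ)) ++ seg μ (v μ - 1)) = disp (s.flatMap (fun κ => seg κ (v κ)) ++ seg μ (v μ)) - e μ :=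
    disp_prefix_pred _ μ (v μ)
  have hfix : ∀ k : ℕ, disp (s.flatMap (fun κ => seg κ (v κ)) ++ seg μ (v μ)) - e μ + disp ((t.flatMap (fun κ => seg κ (v κ))).take k)
      = disp (s.flatMap (fun κ => seg κ (v κ)) ++ seg μ (v μ)) + disp ((t.flatMap (fun κ => seg κ (v κ))).take k) - e μ := fun k => by abel
  simp only [flatMap_seg_sub_e v μ hs, flatMap_seg_sub_e v μ ht, sub_add_cancel, sub_e_apply_self, hq, hfix] at hE
  exact hE

end PerDirection

/-! ## §3 All directions at one site: the site-current form -/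

section Sites

variable {d : ℕ} {𝔸 : Type*} [NormedRing 𝔸] [NormOneClass 𝔸] (V : Site d → Fin d → 𝔸ˣ)
  (hV : ∀ (x : Site d) (κ : Fin d), ‖(V x κ : 𝔸)‖ ≤ 1 ∧ ‖(((V x κ)⁻¹ : 𝔸ˣ) : 𝔸)‖ ≤ 1)
  (s t : Fin d → List (Fin d)) (hsplit : ∀ μ, (List.finRange d).reverse = s μ ++ μ :: t μ)

include hV hsplit in
set_option maxHeartbeats 400000 in
/-- ★★★ **THE COVARIANT LAPLACIAN OF A COMB LOCAL MODEL AT ONE SITE, SITE-CURRENT FORM.**  With `h(x,μ) = V(contour27 0 (rel c x) μ)` and `v = rel c x`, the `μ`-sum of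
✓ `lap_axialModel`'s summands is bounded by: (i) the sum over the SITES `p` of the comb `Γ(0,v)` (run `κ`, position `j`) of the commutator of `m` with the SUM over the directions
`μ` listed before `κ` of `𝒯(p)(P(p,μ) − V(p−e_μ,μ)⁻¹P(p−e_μ,μ)V(p−e_μ,μ))𝒯(p)⁻¹` — at last-run sites all `μ ≠ κ`: the transported CURRENT letter —, plus (ii) `15a·Σ_μ |B_μ|`× the
canonical rung families of the contours at `v` and `v − e_μ` (the FAM integrands).  Window: `a·|B_μ| ≤ 1` for every `μ`.
[cite: Balaban1985RegularSpaces, (1.1)-(1.2) p.76, (1.9) p.77; Balaban1985BackgroundPropagators, (3.3)-(3.4) pp.390-391, (3.8)-(3.9) p.392; Balaban1985Averaging, (9) pp.18-19, (19)-(20) p.21, p.24; Balaban1985UV3, (27) p.263] -/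
theorem norm_lapSum_comb_le_sites (dflt : Letter d) (v : Site d) (m : 𝔸) {a : ℝ} (ha : 0 ≤ a)
    (hplaq : ∀ (μ : Fin d) (x : Site d) (l : Letter d), ‖((hol V x [l, (μ, true), l.rev, (μ, false)] : 𝔸ˣ) : 𝔸) - 1‖ ≤ a)
    (han : ∀ μ : Fin d, a * ((t μ).flatMap (fun κ => seg κ (v κ))).length ≤ 1) :
    ‖∑ μ : Fin d, ((2 : ℕ) • m - R (hol V 0 (contour27 0 (v - e μ) μ))⁻¹ m - R (hol V 0 (contour27 0 v μ)) m)‖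
      ≤ ∑ κ : Fin d, ∑ j ∈ Finset.range (v κ).natAbs,
            ‖(∑ μ ∈ (s κ).toFinset, ((hol V 0 (treeWord (disp ((s κ).flatMap (fun ν => seg ν (v ν))) + disp ((seg κ (v κ)).take j))) : 𝔸ˣ) : 𝔸) * (((hol V (disp ((s κ).flatMap (fun ν => seg ν (v ν))) + disp ((seg κ (v κ)).take j)) [(seg κ (v κ)).getD j dflt, (μ, true), ((seg κ (v κ)).getD j dflt).rev, (μ, false)] : 𝔸ˣ) : 𝔸) - ((((V ((disp ((s κ).flatMap (fun ν => seg ν (v ν))) + disp ((seg κ (v κ)).take j)) - e μ) μ)⁻¹ * hol V ((disp ((s κ).flatMap (fun ν => seg ν (v ν))) + disp ((seg κ (v κ)).take j)) - e μ) [(seg κ (v κ)).getD j dflt, (μ, true), ((seg κ (v κ)).getD j dflt).rev, (μ, false)] * ((V ((disp ((s κ).flatMap (fun ν => seg ν (v ν))) + disp ((seg κ (v κ)).take j)) - e μ) μ)⁻¹)⁻¹ : 𝔸ˣ) : 𝔸))) * (((hol V 0 (treeWord (disp ((s κ).flatMap (fun ν => seg ν (v ν))) + disp ((seg κ (v κ)).take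 j))))⁻¹ : 𝔸ˣ) : 𝔸)) * m
              - m * ∑ μ ∈ (s κ).toFinset, ((hol V 0 (treeWord (disp ((s κ).flatMap (fun ν => seg ν (v ν))) + disp ((seg κ (v κ)).take j))) : 𝔸ˣ) : 𝔸) * (((hol V (disp ((s κ).flatMap (fun ν => seg ν (v ν))) + disp ((seg κ (v κ)).take j)) [(seg κ (v κ)).getD j dflt, (μ, true), ((seg κ (v κ)).getD j dflt).rev, (μ, false)] : 𝔸ˣ) : 𝔸) - ((((V ((disp ((s κ).flatMap (fun ν => seg ν (v ν))) + disp ((seg κ (v κ)).take j)) - e μ) μ)⁻¹ * hol V ((disp ((s κ).flatMap (fun ν => seg ν (v ν))) + disp ((seg κ (v κ)).take j)) - e μ) [(seg κ (v κ)).getD j dflt, (μ, true), ((seg κ (v κ)).getD j dflt).rev, (μ, false)] * ((V ((disp ((s κ).flatMap (fun ν => seg ν (v ν))) + disp ((seg κ (v κ)).take j)) - e μ) μ)⁻¹)⁻¹ : 𝔸ˣ) : 𝔸))) * (((hol V 0 (treeWord (disp ((s κ).flatMap (fun ν => seg ν (v ν))) + disp ((seg κ (v κ)).take j))))⁻¹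 : 𝔸ˣ) : 𝔸)‖
        + ∑ μ : Fin d, 15 * a * ((t μ).flatMap (fun κ => seg κ (v κ))).length
            * (∑ k ∈ Finset.range ((t μ).flatMap (fun κ => seg κ (v κ))).length, ‖((hol V (disp ((s μ).flatMap (fun κ => seg κ (v κ)) ++ seg μ (v μ)) + disp (((t μ).flatMap (fun κ => seg κ (v κ))).take k)) [((t μ).flatMap (fun κ => seg κ (v κ))).getD k (μ, true), (μ, true), (((t μ).flatMap (fun κ => seg κ (v κ))).getD k (μ, true)).rev, (μ, false)] : 𝔸ˣ) : 𝔸) * R (hol V 0 (treeWord (disp ((s μ).flatMap (fun κ => seg κ (v κ)) ++ seg μ (v μ)) + disp (((t μ).flatMap (fun κ => seg κ (v κ))).take k))))⁻¹ m - R (hol V 0 (treeWord (disp ((s μ).flatMap (fun κ => seg κ (v κ)) ++ seg μ (v μ)) + disp (((t μ).flatMap (fun κ => seg κ (v κ))).take k))))⁻¹ m * ((hol V (disp ((s μ).flatMap (fun κ => seg κ (v κ)) ++ seg μ (v μ)) + disp (((t μ).flatMap (fun κ => seg κ (v κ))).take k)) [((t μ).flatMap (fun κ => seg κ (v κ))).getD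 k (μ, true), (μ, true), (((t μ).flatMap (fun κ => seg κ (v κ))).getD k (μ, true)).rev, (μ, false)] : 𝔸ˣ) : 𝔸)‖
              + ∑ k ∈ Finset.range ((t μ).flatMap (fun κ => seg κ (v κ))).length, ‖((hol V ((disp ((s μ).flatMap (fun κ => seg κ (v κ)) ++ seg μ (v μ)) + disp (((t μ).flatMap (fun κ => seg κ (v κ))).take k)) - e μ) [((t μ).flatMap (fun κ => seg κ (v κ))).getD k (μ, true), (μ, true), (((t μ).flatMap (fun κ => seg κ (v κ))).getD k (μ, true)).rev, (μ, false)] : 𝔸ˣ) : 𝔸) * R (hol V 0 (treeWord ((disp ((s μ).flatMap (fun κ => seg κ (v κ)) ++ seg μ (v μ)) + disp (((t μ).flatMap (fun κ => seg κ (v κ))).take k)) - e μ)))⁻¹ m - R (hol V 0 (treeWord ((disp ((s μ).flatMap (fun κ => seg κ (v κ)) ++ seg μ (v μ)) + disp (((t μ).flatMap (fun κ => seg κ (v κ))).take k)) - e μ)))⁻¹ m * ((hol V ((disp ((s μ).flatMap (fun κ => seg κ (v κ)) ++ seg μ (v μ)) + disp (((t μ).flatMap (fun κ => seg κ (v κ))).take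 k)) - e μ) [((t μ).flatMap (fun κ => seg κ (v κ))).getD k (μ, true), (μ, true), (((t μ).flatMap (fun κ => seg κ (v κ))).getD k (μ, true)).rev, (μ, false)] : 𝔸ˣ) : 𝔸)‖) := by
  classical
  -- the local term as a function of (direction, point, letter)
  set g : Fin d → Site d → Letter d → 𝔸 := fun μ p l =>
    ((hol V 0 (treeWord p) : 𝔸ˣ) : 𝔸) * (((hol V p [l, (μ, true), (l).rev, (μ, false)] : 𝔸ˣ) : 𝔸) - ((((V (p - e μ) μ)⁻¹ * hol V (p - e μ) [l, (μ, true), (l).rev, (μ, false)] * ((V (p - e μ) μ)⁻¹)⁻¹ : 𝔸ˣ) : 𝔸))) * (((hol V 0 (treeWord p))⁻¹ : 𝔸ˣ) : 𝔸) with hg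
  -- per direction (§2), letters `(μ, true)` replaced by `dflt` inside the range
  have hdir : ∀ μ : Fin d,
      ‖((2 : ℕ) • m - R (hol V 0 (contour27 0 (v - e μ) μ))⁻¹ m - R (hol V 0 (contour27 0 v μ)) m)
          + ((∑ k ∈ Finset.range ((t μ).flatMap (fun κ => seg κ (v κ))).length, g μ (disp ((s μ).flatMap (fun κ => seg κ (v κ)) ++ seg μ (v μ)) + disp (((t μ).flatMap (fun κ => seg κ (v κ))).take k)) (((t μ).flatMap (fun κ => seg κ (v κ))).getD k dflt)) * m
            - m * ∑ k ∈ Finset.range ((t μ).flatMap (fun κ => seg κ (v κ))).length, g μ (disp ((s μ).flatMap (fun κ => seg κ (v κ)) ++ seg μ (v μ)) + disp (((t μ).flatMap (fun κ => seg κ (v κ))).take k)) (((t μ).flatMap (fun κ => seg κ (v κ))).getD k dflt))‖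
        ≤ 15 * a * ((t μ).flatMap (fun κ => seg κ (v κ))).length
            * (∑ k ∈ Finset.range ((t μ).flatMap (fun κ => seg κ (v κ))).length, ‖((hol V (disp ((s μ).flatMap (fun κ => seg κ (v κ)) ++ seg μ (v μ)) + disp (((t μ).flatMap (fun κ => seg κ (v κ))).take k)) [((t μ).flatMap (fun κ => seg κ (v κ))).getD k (μ, true), (μ, true), (((t μ).flatMap (fun κ => seg κ (v κ))).getD k (μ, true)).rev, (μ, false)] : 𝔸ˣ) : 𝔸) * R (hol V 0 (treeWord (disp ((s μ).flatMap (fun κ => seg κ (v κ)) ++ seg μ (v μ)) + disp (((t μ).flatMap (fun κ => seg κ (v κ))).take k))))⁻¹ m - R (hol V 0 (treeWord (disp ((s μ).flatMap (fun κ => seg κ (v κ)) ++ seg μ (v μ)) + disp (((t μ).flatMap (fun κ => seg κ (v κ))).take k))))⁻¹ m * ((hol V (disp ((s μ).flatMap (fun κ => seg κ (v κ)) ++ seg μ (v μ)) + disp (((t μ).flatMap (fun κ => seg κ (v κ))).take k)) [((t μ).flatMap (fun κ => seg κ (v κ))).getD k (μ, true), (μ, true), (((t μ).flatMap (fun κ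 => seg κ (v κ))).getD k (μ, true)).rev, (μ, false)] : 𝔸ˣ) : 𝔸)‖
              + ∑ k ∈ Finset.range ((t μ).flatMap (fun κ => seg κ (v κ))).length, ‖((hol V ((disp ((s μ).flatMap (fun κ => seg κ (v κ)) ++ seg μ (v μ)) + disp (((t μ).flatMap (fun κ => seg κ (v κ))).take k)) - e μ) [((t μ).flatMap (fun κ => seg κ (v κ))).getD k (μ, true), (μ, true), (((t μ).flatMap (fun κ => seg κ (v κ))).getD k (μ, true)).rev, (μ, false)] : 𝔸ˣ) : 𝔸) * R (hol V 0 (treeWord ((disp ((s μ).flatMap (fun κ => seg κ (v κ)) ++ seg μ (v μ)) + disp (((t μ).flatMap (fun κ => seg κ (v κ))).take k)) - e μ)))⁻¹ m - R (hol V 0 (treeWord ((disp ((s μ).flatMap (fun κ => seg κ (v κ)) ++ seg μ (v μ)) + disp (((t μ).flatMap (fun κ => seg κ (v κ))).take k)) - e μ)))⁻¹ m * ((hol V ((disp ((s μ).flatMap (fun κ => seg κ (v κ)) ++ seg μ (v μ)) + disp (((t μ).flatMap (fun κ => seg κ (v κ))).take k)) - e μ) [((t μ).flatMap (fun κ =>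 seg κ (v κ))).getD k (μ, true), (μ, true), (((t μ).flatMap (fun κ => seg κ (v κ))).getD k (μ, true)).rev, (μ, false)] : 𝔸ˣ) : 𝔸)‖) := fun μ => by
    obtain ⟨-, -, hs, ht, -⟩ := Prop7CombLadderCount.split_nodup μ (hsplit μ)
    have h2 := norm_lapDefect_comb_add_comm_local_le' V hV μ (hsplit μ) hs ht v m ha (hplaq μ) (han μ)
    have hsum : ∑ k ∈ Finset.range ((t μ).flatMap (fun κ => seg κ (v κ))).length, g μ (disp ((s μ).flatMap (fun κ => seg κ (v κ)) ++ seg μ (v μ)) + disp (((t μ).flatMap (fun κ => seg κ (v κ))).take k)) (((t μ).flatMap (fun κ => seg κ (v κ))).getD k dflt)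
        = ∑ k ∈ Finset.range ((t μ).flatMap (fun κ => seg κ (v κ))).length, g μ (disp ((s μ).flatMap (fun κ => seg κ (v κ)) ++ seg μ (v μ)) + disp (((t μ).flatMap (fun κ => seg κ (v κ))).take k)) (((t μ).flatMap (fun κ => seg κ (v κ))).getD k (μ, true)) :=
      Finset.sum_congr rfl fun k hk => by
        rw [List.getD_eq_getElem _ _ (Finset.mem_range.mp hk), List.getD_eq_getElem _ _ (Finset.mem_range.mp hk)]
    rw [hsum]
    simpa only [hg] using h2
  -- sum over directions: `Σ_μ E_μ = Σ_μ (E_μ + C_μ) − [Σ_μ Σ_k g, m]`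
  set E : Fin d → 𝔸 := fun μ => (2 : ℕ) • m - R (hol V 0 (contour27 0 (v - e μ) μ))⁻¹ m - R (hol V 0 (contour27 0 v μ)) m with hE
  set X : Fin d → 𝔸 := fun μ => ∑ k ∈ Finset.range ((t μ).flatMap (fun κ => seg κ (v κ))).length, g μ (disp ((s μ).flatMap (fun κ => seg κ (v κ)) ++ seg μ (v μ)) + disp (((t μ).flatMap (fun κ => seg κ (v κ))).take k)) (((t μ).flatMap (fun κ => seg κ (v κ))).getD k dflt) with hX
  have e1 : ∑ μ : Fin d, E μ = ∑ μ : Fin d, (E μ + (X μ * m - m * X μ)) - ((∑ μ : Fin d, X μ) * m - m * ∑ μ : Fin d, X μ) := by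
    rw [Finset.sum_mul, Finset.mul_sum, ← Finset.sum_sub_distrib, Finset.sum_add_distrib, add_sub_cancel_right]
  have hD := norm_comm_sum_dirs_tailRungs_le s t hsplit g dflt v m
  have step : ‖∑ μ : Fin d, E μ‖ ≤ ∑ μ : Fin d, ‖E μ + (X μ * m - m * X μ)‖ + ‖(∑ μ : Fin d, X μ) * m - m * ∑ μ : Fin d, X μ‖ := by
    rw [e1]; exact (norm_sub_le _ _).trans (add_le_add (norm_sum_le _ _) le_rfl)
  have hA := Finset.sum_le_sum fun μ (_ : μ ∈ (Finset.univ : Finset (Fin d))) => show ‖E μ + (X μ * m - m * X μ)‖ ≤ _ from by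
    simpa only [hE, hX] using hdir μ
  have hB := show ‖(∑ μ : Fin d, X μ) * m - m * ∑ μ : Fin d, X μ‖ ≤ _ from by simpa only [hX, hg] using hD
  have e0 : ‖∑ μ : Fin d, ((2 : ℕ) • m - R (hol V 0 (contour27 0 (v - e μ) μ))⁻¹ m - R (hol V 0 (contour27 0 v μ)) m)‖ = ‖∑ μ : Fin d, E μ‖ := by
    simp only [hE]
  rw [e0]
  calc ‖∑ μ : Fin d, E μ‖ ≤ ∑ μ : Fin d, ‖E μ + (X μ * m - m * X μ)‖ + ‖(∑ μ : Fin d, X μ) * m - m * ∑ μ : Fin d, X μ‖ := step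
    _ ≤ _ := add_le_add hA hB
    _ = _ := add_comm _ _

end Sites

/-! ## §4 The same with the first-order term EXACT (linear) — the form the offset-family telescoping consumes -/

section SitesExact

variable {d : ℕ} {𝔸 : Type*} [NormedRing 𝔸] [NormOneClass 𝔸] (V : Site d → Fin d → 𝔸ˣ)
  (hV : ∀ (x : Site d) (κ : Fin d), ‖(V x κ : 𝔸)‖ ≤ 1 ∧ ‖(((V x κ)⁻¹ : 𝔸ˣ) : 𝔸)‖ ≤ 1)
  (s t : Fin d → List (Fin d)) (hsplit : ∀ μ, (List.finRange d).reverse = s μ ++ μ :: t μ)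

include hV hsplit in
set_option maxHeartbeats 400000 in
/-- ★★★ **THE COVARIANT LAPLACIAN OF A COMB LOCAL MODEL AT ONE SITE — FIRST ORDER EXACT, REGROUPED BY SITE**: the `μ`-sum of ✓ `lap_axialModel`'s summands PLUS the commutator of
`m` with the site-regrouped sum of the transported local covariant curvature differences is pure junk: `≤ 15a·Σ_μ|B_μ|`× the canonical rung families.  (✓ `norm_lapSum_comb_le_sites`
is this followed by the triangle inequality over sites; the offset-family average of the (H)-road needs the κ ≥ 1 runs kept LINEAR across the offsets — this form.)
[cite: Balaban1985RegularSpaces, (1.1)-(1.2) p.76, (1.9) p.77; Balaban1985BackgroundPropagators, (3.3)-(3.4) pp.390-391, (3.8)-(3.9) p.392; Balaban1985Averaging, (9) pp.18-19, (19)-(20) p.21, p.24; Balaban1985UV3, (27) p.263] -/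
theorem norm_lapSum_comb_add_comm_sites_le (dflt : Letter d) (v : Site d) (m : 𝔸) {a : ℝ} (ha : 0 ≤ a)
    (hplaq : ∀ (μ : Fin d) (x : Site d) (l : Letter d), ‖((hol V x [l, (μ, true), l.rev, (μ, false)] : 𝔸ˣ) : 𝔸) - 1‖ ≤ a)
    (han : ∀ μ : Fin d, a * ((t μ).flatMap (fun κ => seg κ (v κ))).length ≤ 1) :
    ‖(∑ μ : Fin d, ((2 : ℕ) • m - R (hol V 0 (contour27 0 (v - e μ) μ))⁻¹ m - R (hol V 0 (contour27 0 v μ)) m))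
        + ((∑ κ : Fin d, ∑ j ∈ Finset.range (v κ).natAbs, ∑ μ ∈ (s κ).toFinset, ((hol V 0 (treeWord (disp ((s κ).flatMap (fun ν => seg ν (v ν))) + disp ((seg κ (v κ)).take j))) : 𝔸ˣ) : 𝔸) * (((hol V (disp ((s κ).flatMap (fun ν => seg ν (v ν))) + disp ((seg κ (v κ)).take j)) [(seg κ (v κ)).getD j dflt, (μ, true), ((seg κ (v κ)).getD j dflt).rev, (μ, false)] : 𝔸ˣ) : 𝔸) - ((((V ((disp ((s κ).flatMap (fun ν => seg ν (v ν))) + disp ((seg κ (v κ)).take j)) - e μ) μ)⁻¹ * hol V ((disp ((s κ).flatMap (fun ν => seg ν (v ν))) + disp ((seg κ (v κ)).take j)) - e μ) [(seg κ (v κ)).getD j dflt, (μ, true), ((seg κ (v κ)).getD j dflt).rev, (μ, false)] * ((V ((disp ((s κ).flatMap (fun ν => seg ν (v ν))) + disp ((seg κ (v κ)).take j)) - e μ) μ)⁻¹)⁻¹ : 𝔸ˣ) : 𝔸))) * (((hol V 0 (treeWord (disp ((s κ).flatMap (fun ν => seg ν (v ν))) + disp ((seg κ (v κ)).take j))))⁻¹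 : 𝔸ˣ) : 𝔸)) * m
          - m * ∑ κ : Fin d, ∑ j ∈ Finset.range (v κ).natAbs, ∑ μ ∈ (s κ).toFinset, ((hol V 0 (treeWord (disp ((s κ).flatMap (fun ν => seg ν (v ν))) + disp ((seg κ (v κ)).take j))) : 𝔸ˣ) : 𝔸) * (((hol V (disp ((s κ).flatMap (fun ν => seg ν (v ν))) + disp ((seg κ (v κ)).take j)) [(seg κ (v κ)).getD j dflt, (μ, true), ((seg κ (v κ)).getD j dflt).rev, (μ, false)] : 𝔸ˣ) : 𝔸) - ((((V ((disp ((s κ).flatMap (fun ν => seg ν (v ν))) + disp ((seg κ (v κ)).take j)) - e μ) μ)⁻¹ * hol V ((disp ((s κ).flatMap (fun ν => seg ν (v ν))) + disp ((seg κ (v κ)).take j)) - e μ) [(seg κ (v κ)).getD j dflt, (μ, true), ((seg κ (v κ)).getD j dflt).rev, (μ, false)] * ((V ((disp ((s κ).flatMap (fun ν => seg ν (v ν))) + disp ((seg κ (v κ)).take j)) - e μ) μ)⁻¹)⁻¹ : 𝔸ˣ) : 𝔸))) * (((hol V 0 (treeWord (disp ((s κ).flatMap (fun ν => seg ν (v ν)))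 + disp ((seg κ (v κ)).take j))))⁻¹ : 𝔸ˣ) : 𝔸))‖
      ≤ ∑ μ : Fin d, 15 * a * ((t μ).flatMap (fun κ => seg κ (v κ))).length
            * (∑ k ∈ Finset.range ((t μ).flatMap (fun κ => seg κ (v κ))).length, ‖((hol V (disp ((s μ).flatMap (fun κ => seg κ (v κ)) ++ seg μ (v μ)) + disp (((t μ).flatMap (fun κ => seg κ (v κ))).take k)) [((t μ).flatMap (fun κ => seg κ (v κ))).getD k (μ, true), (μ, true), (((t μ).flatMap (fun κ => seg κ (v κ))).getD k (μ, true)).rev, (μ, false)] : 𝔸ˣ) : 𝔸) * R (hol V 0 (treeWord (disp ((s μ).flatMap (fun κ => seg κ (v κ)) ++ seg μ (v μ)) + disp (((t μ).flatMap (fun κ => seg κ (v κ))).take k))))⁻¹ m - R (hol V 0 (treeWord (disp ((s μ).flatMap (fun κ => seg κ (v κ)) ++ seg μ (v μ)) + disp (((t μ).flatMap (fun κ => seg κ (v κ))).take k))))⁻¹ m * ((hol V (disp ((s μ).flatMap (fun κ => seg κ (v κ)) ++ seg μ (v μ)) + disp (((t μ).flatMap (fun κ => seg κ (v κ))).take k))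 [((t μ).flatMap (fun κ => seg κ (v κ))).getD k (μ, true), (μ, true), (((t μ).flatMap (fun κ => seg κ (v κ))).getD k (μ, true)).rev, (μ, false)] : 𝔸ˣ) : 𝔸)‖
              + ∑ k ∈ Finset.range ((t μ).flatMap (fun κ => seg κ (v κ))).length, ‖((hol V ((disp ((s μ).flatMap (fun κ => seg κ (v κ)) ++ seg μ (v μ)) + disp (((t μ).flatMap (fun κ => seg κ (v κ))).take k)) - e μ) [((t μ).flatMap (fun κ => seg κ (v κ))).getD k (μ, true), (μ, true), (((t μ).flatMap (fun κ => seg κ (v κ))).getD k (μ, true)).rev, (μ, false)] : 𝔸ˣ) : 𝔸) * R (hol V 0 (treeWord ((disp ((s μ).flatMap (fun κ => seg κ (v κ)) ++ seg μ (v μ)) + disp (((t μ).flatMap (fun κ => seg κ (v κ))).take k)) - e μ)))⁻¹ m - R (hol V 0 (treeWord ((disp ((s μ).flatMap (fun κ => seg κ (v κ)) ++ seg μ (v μ)) + disp (((t μ).flatMap (fun κ => seg κ (v κ))).take k)) - e μ)))⁻¹ m * ((hol V ((disp ((s μ).flatMap (fun κ => seg κ (v κ)) ++ seg μ (v μ))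 + disp (((t μ).flatMap (fun κ => seg κ (v κ))).take k)) - e μ) [((t μ).flatMap (fun κ => seg κ (v κ))).getD k (μ, true), (μ, true), (((t μ).flatMap (fun κ => seg κ (v κ))).getD k (μ, true)).rev, (μ, false)] : 𝔸ˣ) : 𝔸)‖) := by
  classical
  set g : Fin d → Site d → Letter d → 𝔸 := fun μ p l =>
    ((hol V 0 (treeWord p) : 𝔸ˣ) : 𝔸) * (((hol V p [l, (μ, true), (l).rev, (μ, false)] : 𝔸ˣ) : 𝔸) - ((((V (p - e μ) μ)⁻¹ * hol V (p - e μ) [l, (μ, true), (l).rev, (μ, false)] * ((V (p - e μ) μ)⁻¹)⁻¹ : 𝔸ˣ) : 𝔸))) * (((hol V 0 (treeWord p))⁻¹ : 𝔸ˣ) : 𝔸) with hg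
  have hdir : ∀ μ : Fin d,
      ‖((2 : ℕ) • m - R (hol V 0 (contour27 0 (v - e μ) μ))⁻¹ m - R (hol V 0 (contour27 0 v μ)) m)
          + ((∑ k ∈ Finset.range ((t μ).flatMap (fun κ => seg κ (v κ))).length, g μ (disp ((s μ).flatMap (fun κ => seg κ (v κ)) ++ seg μ (v μ)) + disp (((t μ).flatMap (fun κ => seg κ (v κ))).take k)) (((t μ).flatMap (fun κ => seg κ (v κ))).getD k dflt)) * m
            - m * ∑ k ∈ Finset.range ((t μ).flatMap (fun κ => seg κ (v κ))).length, g μ (disp ((s μ).flatMap (fun κ => seg κ (v κ)) ++ seg μ (v μ)) + disp (((t μ).flatMap (fun κ => seg κ (v κ))).take k)) (((t μ).flatMap (fun κ => seg κ (v κ))).getD k dflt))‖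
        ≤ 15 * a * ((t μ).flatMap (fun κ => seg κ (v κ))).length
            * (∑ k ∈ Finset.range ((t μ).flatMap (fun κ => seg κ (v κ))).length, ‖((hol V (disp ((s μ).flatMap (fun κ => seg κ (v κ)) ++ seg μ (v μ)) + disp (((t μ).flatMap (fun κ => seg κ (v κ))).take k)) [((t μ).flatMap (fun κ => seg κ (v κ))).getD k (μ, true), (μ, true), (((t μ).flatMap (fun κ => seg κ (v κ))).getD k (μ, true)).rev, (μ, false)] : 𝔸ˣ) : 𝔸) * R (hol V 0 (treeWord (disp ((s μ).flatMap (fun κ => seg κ (v κ)) ++ seg μ (v μ)) + disp (((t μ).flatMap (fun κ => seg κ (v κ))).take k))))⁻¹ m - R (hol V 0 (treeWord (disp ((s μ).flatMap (fun κ => seg κ (v κ)) ++ seg μ (v μ)) + disp (((t μ).flatMap (fun κ => seg κ (v κ))).take k))))⁻¹ m * ((hol V (disp ((s μ).flatMap (fun κ => seg κ (v κ)) ++ seg μ (v μ)) + disp (((t μ).flatMap (fun κ => seg κ (v κ))).take k)) [((t μ).flatMap (fun κ => seg κ (v κ))).getD k (μ, true), (μ, true), (((t μ).flatMap (fun κ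 => seg κ (v κ))).getD k (μ, true)).rev, (μ, false)] : 𝔸ˣ) : 𝔸)‖
              + ∑ k ∈ Finset.range ((t μ).flatMap (fun κ => seg κ (v κ))).length, ‖((hol V ((disp ((s μ).flatMap (fun κ => seg κ (v κ)) ++ seg μ (v μ)) + disp (((t μ).flatMap (fun κ => seg κ (v κ))).take k)) - e μ) [((t μ).flatMap (fun κ => seg κ (v κ))).getD k (μ, true), (μ, true), (((t μ).flatMap (fun κ => seg κ (v κ))).getD k (μ, true)).rev, (μ, false)] : 𝔸ˣ) : 𝔸) * R (hol V 0 (treeWord ((disp ((s μ).flatMap (fun κ => seg κ (v κ)) ++ seg μ (v μ)) + disp (((t μ).flatMap (fun κ => seg κ (v κ))).take k)) - e μ)))⁻¹ m - R (hol V 0 (treeWord ((disp ((s μ).flatMap (fun κ => seg κ (v κ)) ++ seg μ (v μ)) + disp (((t μ).flatMap (fun κ => seg κ (v κ))).take k)) - e μ)))⁻¹ m * ((hol V ((disp ((s μ).flatMap (fun κ => seg κ (v κ)) ++ seg μ (v μ)) + disp (((t μ).flatMap (fun κ => seg κ (v κ))).take k)) - e μ) [((t μ).flatMap (fun κ =>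 seg κ (v κ))).getD k (μ, true), (μ, true), (((t μ).flatMap (fun κ => seg κ (v κ))).getD k (μ, true)).rev, (μ, false)] : 𝔸ˣ) : 𝔸)‖) := fun μ => by
    obtain ⟨-, -, hs, ht, -⟩ := Prop7CombLadderCount.split_nodup μ (hsplit μ)
    have h2 := norm_lapDefect_comb_add_comm_local_le' V hV μ (hsplit μ) hs ht v m ha (hplaq μ) (han μ)
    have hsum : ∑ k ∈ Finset.range ((t μ).flatMap (fun κ => seg κ (v κ))).length, g μ (disp ((s μ).flatMap (fun κ => seg κ (v κ)) ++ seg μ (v μ)) + disp (((t μ).flatMap (fun κ => seg κ (v κ))).take k)) (((t μ).flatMap (fun κ => seg κ (v κ))).getD k dflt)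
        = ∑ k ∈ Finset.range ((t μ).flatMap (fun κ => seg κ (v κ))).length, g μ (disp ((s μ).flatMap (fun κ => seg κ (v κ)) ++ seg μ (v μ)) + disp (((t μ).flatMap (fun κ => seg κ (v κ))).take k)) (((t μ).flatMap (fun κ => seg κ (v κ))).getD k (μ, true)) :=
      Finset.sum_congr rfl fun k hk => by
        rw [List.getD_eq_getElem _ _ (Finset.mem_range.mp hk), List.getD_eq_getElem _ _ (Finset.mem_range.mp hk)]
    rw [hsum]
    simpa only [hg] using h2
  set E : Fin d → 𝔸 := fun μ => (2 : ℕ) • m - R (hol V 0 (contour27 0 (v - e μ) μ))⁻¹ m - R (hol V 0 (contour27 0 v μ)) m with hE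
  set X : Fin d → 𝔸 := fun μ => ∑ k ∈ Finset.range ((t μ).flatMap (fun κ => seg κ (v κ))).length, g μ (disp ((s μ).flatMap (fun κ => seg κ (v κ)) ++ seg μ (v μ)) + disp (((t μ).flatMap (fun κ => seg κ (v κ))).take k)) (((t μ).flatMap (fun κ => seg κ (v κ))).getD k dflt) with hX
  -- the site-regrouped sum IS `Σ_μ X μ` (✓ `sum_dirs_tailRungs_eq_sum_sites`)
  have hreg := Prop7LapCombRegroup.sum_dirs_tailRungs_eq_sum_sites s t hsplit g dflt v
  have e1 : ∑ μ : Fin d, (E μ + (X μ * m - m * X μ)) = (∑ μ : Fin d, E μ) + ((∑ μ : Fin d, X μ) * m - m * ∑ μ : Fin d, X μ) := by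
    rw [Finset.sum_add_distrib, Finset.sum_mul, Finset.mul_sum, ← Finset.sum_sub_distrib]
  have e0 : (∑ μ : Fin d, ((2 : ℕ) • m - R (hol V 0 (contour27 0 (v - e μ) μ))⁻¹ m - R (hol V 0 (contour27 0 v μ)) m))
        + ((∑ κ : Fin d, ∑ j ∈ Finset.range (v κ).natAbs, ∑ μ ∈ (s κ).toFinset, ((hol V 0 (treeWord (disp ((s κ).flatMap (fun ν => seg ν (v ν))) + disp ((seg κ (v κ)).take j))) : 𝔸ˣ) : 𝔸) * (((hol V (disp ((s κ).flatMap (fun ν => seg ν (v ν))) + disp ((seg κ (v κ)).take j)) [(seg κ (v κ)).getD j dflt, (μ, true), ((seg κ (v κ)).getD j dflt).rev, (μ, false)] : 𝔸ˣ) : 𝔸) - ((((V ((disp ((s κ).flatMap (fun ν => seg ν (v ν))) + disp ((seg κ (v κ)).take j)) - e μ) μ)⁻¹ * hol V ((disp ((s κ).flatMap (fun ν => seg ν (v ν))) + disp ((seg κ (v κ)).take j)) - e μ) [(seg κ (v κ)).getD j dflt, (μ, true), ((seg κ (v κ)).getD j dflt).rev, (μ, false)] * ((V ((disp ((s κ).flatMap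 (fun ν => seg ν (v ν))) + disp ((seg κ (v κ)).take j)) - e μ) μ)⁻¹)⁻¹ : 𝔸ˣ) : 𝔸))) * (((hol V 0 (treeWord (disp ((s κ).flatMap (fun ν => seg ν (v ν))) + disp ((seg κ (v κ)).take j))))⁻¹ : 𝔸ˣ) : 𝔸)) * m
          - m * ∑ κ : Fin d, ∑ j ∈ Finset.range (v κ).natAbs, ∑ μ ∈ (s κ).toFinset, ((hol V 0 (treeWord (disp ((s κ).flatMap (fun ν => seg ν (v ν))) + disp ((seg κ (v κ)).take j))) : 𝔸ˣ) : 𝔸) * (((hol V (disp ((s κ).flatMap (fun ν => seg ν (v ν))) + disp ((seg κ (v κ)).take j)) [(seg κ (v κ)).getD j dflt, (μ, true), ((seg κ (v κ)).getD j dflt).rev, (μ, false)] : 𝔸ˣ) : 𝔸) - ((((V ((disp ((s κ).flatMap (fun ν => seg ν (v ν))) + disp ((seg κ (v κ)).take j)) - e μ) μ)⁻¹ * hol V ((disp ((s κ).flatMap (fun ν => seg ν (v ν))) + disp ((seg κ (v κ)).take j)) - e μ) [(seg κ (v κ)).getD j dflt, (μ, true), ((seg κ (v κ)).getD j dflt).rev,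 (μ, false)] * ((V ((disp ((s κ).flatMap (fun ν => seg ν (v ν))) + disp ((seg κ (v κ)).take j)) - e μ) μ)⁻¹)⁻¹ : 𝔸ˣ) : 𝔸))) * (((hol V 0 (treeWord (disp ((s κ).flatMap (fun ν => seg ν (v ν))) + disp ((seg κ (v κ)).take j))))⁻¹ : 𝔸ˣ) : 𝔸))
      = ∑ μ : Fin d, (E μ + (X μ * m - m * X μ)) := by
    rw [e1]
    simp only [hE, hX, hg] at hreg ⊢
    rw [hreg]
  rw [e0]
  refine (norm_sum_le _ _).trans (Finset.sum_le_sum fun μ _ => ?_)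
  simpa only [hE, hX] using hdir μ

end SitesExact

end Summit.QuantumFields.YangMills.Theorems.Prop7LapCombSites

end
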